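import Literature.NumberTheory.Automorphic.SatakeTransformDualityGL
import Literature.NumberTheory.Automorphic.SatakeIsomorphismCharPGL
import HarnessLib

/-!
# The modulus of the Borel of `GL_n` as an index: `[ϖ^μ U(𝒪) ϖ^{-μ} : U(𝒪)] = q^{Σᵢ μᵢ (2i + 1 - n)} = q^{Σ_{i<j} (μⱼ - μᵢ)}`
# for `μ` monotone (Laumon (4.1.4) `δ_B = ∏_{i<j} |bᵢᵢ/bⱼⱼ|`; Macdonald V (2.6)–(2.7); Cartier §IV (4.2)), from the duality
# (g44-#2) and Herzig's count of the left cosets of `K t_r K` (tree `satakeTransform_one_doubleCosetOperator_heckeDiag`)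

Topic `NumberTheory/Automorphic`; namespace `Literature.NumberTheory.Automorphic` (lane `lit-hodgefound`, Track 2 foundations;
seat `lit-hodgefound-p11`, generation 44, row g44-#7).  THEOREMS ONLY: no definition, no named fact, no instance, no notation.
Sequel of `SatakeTransformDualityGL` (the duality `N(g, μ)·[…] = N(g⁻¹, -μ)·[…]` with the modulus kept as an INDEX, and the
dominant-extreme count `#{γ ∈ Kϖ^{-a}K/K : e γ = -a} = [ϖ^aU(𝒪)ϖ^{-a} : U(𝒪)]`, `a` monotone) and `SatakeIsomorphismCharPGL`
(`𝒮_1(T_r) = Σ_{#S = n-r} q^{c(S)} x^{ε_S}` over any `R`).  Here the index is EVALUATED (`F` a non-archimedean local field: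
`ValuativeRel` with DVR valuation ring and FINITE residue field of cardinality `q`).

## The mathematics

`U(𝒪) = N·A ∩ GL_n(𝒪)` (integral upper unitriangular matrices), `t_μ = ϖ^μ = diag(ϖ^{μᵢ})`.  For `μ` MONOTONE
(`μ₀ ≤ ⋯ ≤ μ_{n-1}`; antidominant for the upper triangular Borel) conjugation by `t_μ` DIVIDES the entry `(i, j)`, `i < j`, by
`ϖ^{μⱼ - μᵢ}`, so `U(𝒪) ≤ t_μ U(𝒪) t_μ⁻¹` and the modulus index `E(μ) = [t_μU(𝒪)t_μ⁻¹ : U(𝒪)]` satisfies: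
(i) `E` is multiplicative on the monotone cone (g44-#1 `relIndex_conj_mul_conj`: the index RATIO is multiplicative, and the
other index is `1` on the cone); (ii) `E(k·1) = 1`; (iii) `E(ω_r^-) = q^{r(n-r)}` for `ω_r^- = -𝟙_{i<r}`: by g44-#2
`E(ω_r^-) = #{γ ∈ K ϖ^{𝟙_{i<r}} K/K : e γ = 𝟙_{i<r}}`, `ϖ^{𝟙_{i<r}} = t_r`, and in Herzig's sum the monomial `x^{𝟙_{i<r}}` is
`x^{ε_S}` for the single pivot set `S = {i ≥ r}` with `c(S) = #{(i, j) : i < r ≤ j} = r(n - r)`.  Every monotone `μ` is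
`k·1 + Σ_r c_r ω_r^-` with `c_r = μ_r - μ_{r-1} ≥ 0`, whence (induction on `μ_{n-1} - μ₀`, peeling one `ω_r^-` at the last jump)

  **`[ϖ^μ U(𝒪) ϖ^{-μ} : U(𝒪)] = q^{ψ(μ)}`,  `ψ(μ) = Σᵢ μᵢ (2i + 1 - n) = Σ_{i<j} (μⱼ - μᵢ) = Σ_r c_r r(n-r) ≥ 0`**   (`μ` monotone)

(`relIndex_zpowDiagGL_eq_pow_of_monotone`) — the modulus character `δ_B(ϖ^μ)^{∓1} = ∏_{i<j} |ϖ^{μᵢ - μⱼ}|^{∓1} = q^{±ψ(μ)}`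
of Laumon (4.1.4) / Macdonald V (2.6) read as an index.  Consequences (§5): the index RATIO for every `μ ∈ ℤⁿ` is `q^{ψ(μ)}`
(`relIndex_zpowDiagGL_mul_pow_eq`: `[ϖ^μU : U ∩ ϖ^μU] · q^{ψ(μ)⁻} = [U : U ∩ ϖ^μU] · q^{ψ(μ)⁺}`), hence the duality of g44-#2
in its classical form **`N(g, μ) · q^{ψ(μ)⁺} = N(g⁻¹, -μ) · q^{ψ(μ)⁻}`**, i.e. `N(g, μ) = q^{-ψ(μ)} N(g⁻¹, -μ) = δ_B(ϖ^μ)·N(g⁻¹,-μ)`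
(`card_filter_iwasawaExp_mul_pow_eq`), and the dominant-extreme count **`#{γ ∈ Kϖ^{λ}K/K : e γ = λ} = q^{Σ_{i<j}(λᵢ - λⱼ)}`** for
`λ` ANTITONE (`card_filter_iwasawaExp_orbit_zpowDiagGL_eq_pow`; Macdonald V (2.9): the leading coefficient of `c_λ`).

## What is formalised (theorems only)

* §1 `le_conjAct_zpowDiagGL_smul_inf_of_monotone` (`U(𝒪) ≤ ϖ^μU(𝒪)ϖ^{-μ}`), `relIndex_conjAct_zpowDiagGL_smul_eq_one_of_monotone`,
  `relIndex_zpowDiagGL_eq_one_of_antitone`, **`relIndex_zpowDiagGL_add_of_monotone`** (multiplicativity), `relIndex_zpowDiagGL_const`.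
* §2 `sum_ite_lt_mul_two_mul_add_one_sub` (`Σ_{i<r} (2i+1-n) = -r(n-r)`), `sum_mul_two_mul_add_one_sub_add` (linearity of `ψ`).
* §3 `epsOf_filter_le_eq`, `eq_filter_le_of_epsOf_eq`, `card_univ_filter_val_lt`,
  `card_echelonPositions_filter_le` (`c({i ≥ r}) = r(n-r)`),
  **`card_filter_iwasawaExp_orbit_heckeDiag_eq_pow`** (`#{γ ∈ Kt_rK/K : e γ = 𝟙_{i<r}} = q^{r(n-r)}`),
  **`relIndex_zpowDiagGL_neg_indicator_eq_pow`** (`E(ω_r^-) = q^{r(n-r)}`).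
* §4 `exists_lt_succ_of_monotone_of_ne`, `monotone_add_indicator`, **`relIndex_zpowDiagGL_eq_pow_of_monotone`** (THE FORMULA),
  `sum_mul_two_mul_add_one_sub_nonneg_of_monotone`.
* §5 **`relIndex_zpowDiagGL_mul_pow_eq`** (the ratio for every `μ`), **`card_filter_iwasawaExp_mul_pow_eq`** (the duality with
  `δ_B` explicit), **`card_filter_iwasawaExp_orbit_zpowDiagGL_eq_pow`** (dominant-extreme count).

## References
* [Laumon1995] G. Laumon, *Cohomology of Drinfeld Modular Varieties I*, CUP, (4.1.3)–(4.1.6).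
* [Macdonald1995] I. G. Macdonald, *Symmetric Functions and Hall Polynomials*, 2nd ed. (1995), Ch. V (2.6)–(2.9), (3.4).
* [CartierCorvallis1979] P. Cartier, *Representations of 𝔭-adic groups: a survey*, PSPM 33.1 (1979), §I.3, §IV (4.2).
* [Herzig2010] F. Herzig, *A Satake isomorphism in characteristic p*, Compos. Math. 147 (2011), Thm. 1.2.
* [BruhatTits1972] F. Bruhat, J. Tits, *Groupes réductifs sur un corps local I*, Publ. Math. IHÉS 41 (1972), (4.4.4).
-/

noncomputable section

open scoped MatrixGroups Pointwise
open MulAction ValuativeRel Matrix Finset MonoidAlgebra ConjAct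

namespace Literature.NumberTheory.Automorphic

variable {F : Type*} [Field F] [ValuativeRel F] {n : ℕ}

/-! ## §1 Monotone exponents expand `U(𝒪)`; multiplicativity of the index on the monotone cone -/

section Monotone

variable [IsDiscreteValuationRing 𝒪[F]] {ϖ : F} (hϖ : IsUniformizingElement ϖ)
include hϖ

/-- **`U(𝒪) ≤ ϖ^μ U(𝒪) ϖ^{-μ}` for `μ` monotone** (conjugation by `ϖ^{-μ}`, `-μ` antitone, contracts).
[cite: BruhatTits1972, (4.4.4) (ii)] [cite: CartierCorvallis1979, §IV (4.2)] -/
theorem le_conjAct_zpowDiagGL_smul_inf_of_monotone {μ : Fin n → ℤ} (hμ : Monotone μ) :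
    unipotentTorusGL hϖ.ne_zero ⊓ glInt n F ≤ toConjAct (zpowDiagGL hϖ.ne_zero μ) • (unipotentTorusGL hϖ.ne_zero ⊓ glInt n F) := by
  have h' := conjAct_zpowDiagGL_smul_inf_le_of_antitone hϖ (lam := -μ) hμ.neg
  have e : toConjAct (zpowDiagGL hϖ.ne_zero (-μ)) = (toConjAct (zpowDiagGL hϖ.ne_zero μ))⁻¹ := by
    rw [zpowDiagGL_neg, toConjAct_inv]
  rw [e] at h'
  have h'' := Subgroup.pointwise_smul_le_pointwise_smul_iff (a := toConjAct (zpowDiagGL hϖ.ne_zero μ)) |>.2 h'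
  rwa [smul_inv_smul] at h''

/-- For `μ` monotone the index `[U(𝒪) : U(𝒪) ∩ ϖ^μU(𝒪)ϖ^{-μ}]` is `1`. [cite: CartierCorvallis1979, §IV (4.2)] -/
theorem relIndex_conjAct_zpowDiagGL_smul_eq_one_of_monotone {μ : Fin n → ℤ} (hμ : Monotone μ) :
    (toConjAct (zpowDiagGL hϖ.ne_zero μ) • (unipotentTorusGL hϖ.ne_zero ⊓ glInt n F)).relIndex
      (unipotentTorusGL hϖ.ne_zero ⊓ glInt n F) = 1 :=
  Subgroup.relIndex_eq_one.2 (le_conjAct_zpowDiagGL_smul_inf_of_monotone hϖ hμ)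

/-- For `λ` antitone the index `[ϖ^λU(𝒪)ϖ^{-λ} : U(𝒪) ∩ ϖ^λU(𝒪)ϖ^{-λ}]` is `1`. [cite: CartierCorvallis1979, §IV (4.2)] -/
theorem relIndex_zpowDiagGL_eq_one_of_antitone {lam : Fin n → ℤ} (hlam : Antitone lam) :
    (unipotentTorusGL hϖ.ne_zero ⊓ glInt n F).relIndex
      (toConjAct (zpowDiagGL hϖ.ne_zero lam) • (unipotentTorusGL hϖ.ne_zero ⊓ glInt n F)) = 1 :=
  Subgroup.relIndex_eq_one.2 (conjAct_zpowDiagGL_smul_inf_le_of_antitone hϖ hlam)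

/-- **Multiplicativity of `E(μ) = [ϖ^μU(𝒪)ϖ^{-μ} : U(𝒪)]` on the monotone cone**: `E(μ + μ') = E(μ) E(μ')` for `μ, μ'`
monotone (the index RATIO is multiplicative for all `μ`, and the other index is `1` on the cone).
[cite: Laumon1995, (4.1.4)] [cite: CartierCorvallis1979, §I.3] -/
theorem relIndex_zpowDiagGL_add_of_monotone [IsHeckeTriple (⊤ : Submonoid (GL (Fin n) F)) (glInt n F) (glInt n F)]
    {μ μ' : Fin n → ℤ} (hμ : Monotone μ) (hμ' : Monotone μ') :
    (unipotentTorusGL hϖ.ne_zero ⊓ glInt n F).relIndex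
        (toConjAct (zpowDiagGL hϖ.ne_zero (μ + μ')) • (unipotentTorusGL hϖ.ne_zero ⊓ glInt n F)) =
      (unipotentTorusGL hϖ.ne_zero ⊓ glInt n F).relIndex
          (toConjAct (zpowDiagGL hϖ.ne_zero μ) • (unipotentTorusGL hϖ.ne_zero ⊓ glInt n F)) *
        (unipotentTorusGL hϖ.ne_zero ⊓ glInt n F).relIndex
          (toConjAct (zpowDiagGL hϖ.ne_zero μ') • (unipotentTorusGL hϖ.ne_zero ⊓ glInt n F)) := by
  have h := relIndex_conj_zpowDiagGL_mul hϖ μ μ'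
  rw [relIndex_conjAct_zpowDiagGL_smul_eq_one_of_monotone hϖ (μ := μ + μ') (hμ.add hμ'),
    relIndex_conjAct_zpowDiagGL_smul_eq_one_of_monotone hϖ hμ, relIndex_conjAct_zpowDiagGL_smul_eq_one_of_monotone hϖ hμ',
    one_mul, mul_one, mul_one] at h
  exact h.symm

/-- **Constant exponents** (central `ϖ^k·1`): `E(k·1) = 1`. [cite: CartierCorvallis1979, §IV (4.2)] -/
theorem relIndex_zpowDiagGL_const (k : ℤ) :
    (unipotentTorusGL hϖ.ne_zero ⊓ glInt n F).relIndex
      (toConjAct (zpowDiagGL hϖ.ne_zero (fun _ : Fin n => k)) • (unipotentTorusGL hϖ.ne_zero ⊓ glInt n F)) = 1 :=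
  relIndex_zpowDiagGL_eq_one_of_antitone hϖ fun _ _ _ => le_rfl

end Monotone

/-! ## §2 The exponent `ψ(μ) = Σᵢ μᵢ (2i + 1 - n)`: `ψ(𝟙_{i<r}) = -r(n-r)` and linearity -/

/-- **`Σ_{i<r} (2i + 1 - n) = -r(n - r)`** (`r ≤ n`; for `r = n`: `Σᵢ (2i + 1 - n) = 0`). [cite: Macdonald1995, Ch. V (2.6)] -/
theorem sum_ite_lt_mul_two_mul_add_one_sub {r : ℕ} (hr : r ≤ n) :
    ∑ i : Fin n, (if (i : ℕ) < r then (1 : ℤ) else 0) * (2 * (i : ℕ) + 1 - n) = -((r : ℤ) * (n - r)) := by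
  induction r with
  | zero => simp
  | succ r ih =>
    have hr' : r < n := hr
    have step : ∀ i : Fin n, (if (i : ℕ) < r + 1 then (1 : ℤ) else 0) * (2 * (i : ℕ) + 1 - n) =
        (if (i : ℕ) < r then (1 : ℤ) else 0) * (2 * (i : ℕ) + 1 - n) +
          (if i = ⟨r, hr'⟩ then (2 * (r : ℤ) + 1 - n) else 0) := by
      intro i
      by_cases h1 : (i : ℕ) < r
      · have h2 : i ≠ ⟨r, hr'⟩ := fun h => by rw [h] at h1; exact lt_irrefl _ h1
        rw [if_pos (Nat.lt_succ_of_lt h1), if_pos h1, if_neg h2, add_zero]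
      · by_cases h2 : i = ⟨r, hr'⟩
        · subst h2
          rw [if_pos (Nat.lt_succ_self r), if_neg h1, if_pos rfl, zero_mul, zero_add, one_mul]
        · have h3 : ¬ (i : ℕ) < r + 1 := fun h => by
            rcases Nat.lt_succ_iff_lt_or_eq.1 h with h | h
            · exact h1 h
            · exact h2 (Fin.ext h)
          rw [if_neg h3, if_neg h1, if_neg h2, zero_mul, add_zero]
    rw [Finset.sum_congr rfl fun i _ => step i, Finset.sum_add_distrib, ih hr'.le, Finset.sum_ite_eq' Finset.univ,
      if_pos (Finset.mem_univ _)]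
    push_cast
    ring

/-- Linearity of `ψ`: `ψ(μ + μ') = ψ(μ) + ψ(μ')`. [cite: Macdonald1995, Ch. V (2.6)] -/
theorem sum_mul_two_mul_add_one_sub_add (μ μ' : Fin n → ℤ) :
    ∑ i : Fin n, (μ + μ') i * (2 * (i : ℕ) + 1 - n) =
      ∑ i : Fin n, μ i * (2 * (i : ℕ) + 1 - n) + ∑ i : Fin n, μ' i * (2 * (i : ℕ) + 1 - n) := by
  rw [← Finset.sum_add_distrib]
  exact Finset.sum_congr rfl fun i _ => by rw [Pi.add_apply, add_mul]

/-! ## §3 `E(-𝟙_{i<r}) = #{γ ∈ K t_r K / K : e γ = 𝟙_{i<r}} = q^{r(n-r)}` -/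

/-- The exponent `ε_S` of the pivot set `S = {i : r ≤ i}` is `𝟙_{i<r}`. [cite: Herzig2010, Thm. 1.2] -/
theorem epsOf_filter_le_eq (r : ℕ) :
    (fun i : Fin n => (epsOf (Finset.univ.filter fun i : Fin n => r ≤ (i : ℕ)) i : ℤ)) =
      fun i : Fin n => if (i : ℕ) < r then (1 : ℤ) else 0 := by
  funext i
  by_cases h : (i : ℕ) < r
  · rw [if_pos h, epsOf_of_not_mem (by rw [Finset.mem_filter]; exact fun h' => absurd h'.2 (not_le.2 h)), Nat.cast_one]
  · rw [if_neg h, epsOf_of_mem (by rw [Finset.mem_filter]; exact ⟨Finset.mem_univ _, not_lt.1 h⟩), Nat.cast_zero]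

/-- Conversely `ε_S = 𝟙_{i<r}` forces `S = {i : r ≤ i}`. [cite: Herzig2010, Thm. 1.2] -/
theorem eq_filter_le_of_epsOf_eq {S : Finset (Fin n)} {r : ℕ}
    (h : (fun i : Fin n => (epsOf S i : ℤ)) = fun i : Fin n => if (i : ℕ) < r then (1 : ℤ) else 0) :
    S = Finset.univ.filter fun i : Fin n => r ≤ (i : ℕ) := by
  ext i
  have hi := congr_fun h i
  rw [Finset.mem_filter]
  by_cases hS : i ∈ S
  · rw [epsOf_of_mem hS, Nat.cast_zero] at hi
    refine ⟨fun _ => ⟨Finset.mem_univ _, not_lt.1 fun hlt => ?_⟩, fun _ => hS⟩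
    rw [if_pos hlt] at hi
    exact zero_ne_one hi
  · rw [epsOf_of_not_mem hS, Nat.cast_one] at hi
    refine ⟨fun h' => absurd h' hS, fun h' => ?_⟩
    rw [if_neg (not_lt.2 h'.2)] at hi
    exact absurd hi one_ne_zero

/-- `#{i : Fin n | i < r} = r` for `r ≤ n`. [folklore] [cite: Macdonald1995, Ch. V (2.6)] -/
theorem card_univ_filter_val_lt {r : ℕ} (hr : r ≤ n) : (Finset.univ.filter fun i : Fin n => (i : ℕ) < r).card = r := by
  rw [← Fintype.card_subtype, Fintype.card_fin_lt_of_le hr]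

/-- **`c({i : r ≤ i}) = r(n - r)`**: the echelon positions for the final-segment pivot set are the pairs `(i, j)` with
`i < r ≤ j`. [cite: Herzig2010, Thm. 1.2] [cite: Macdonald1995, Ch. V (2.6)] -/
theorem card_echelonPositions_filter_le {r : ℕ} (hr : r ≤ n) :
    (echelonPositions (Finset.univ.filter fun i : Fin n => r ≤ (i : ℕ))).card = r * (n - r) := by
  have hset : echelonPositions (Finset.univ.filter fun i : Fin n => r ≤ (i : ℕ)) =
      (Finset.univ.filter fun i : Fin n => (i : ℕ) < r) ×ˢ (Finset.univ.filter fun j : Fin n => r ≤ (j : ℕ)) := by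
    ext ⟨i, j⟩
    simp only [echelonPositions, Finset.mem_filter, Finset.mem_univ, true_and, Finset.mem_product, not_le]
    constructor
    · rintro ⟨-, h1, h2⟩; exact ⟨h1, h2⟩
    · rintro ⟨h1, h2⟩; exact ⟨Fin.lt_def.2 (lt_of_lt_of_le h1 h2), h1, h2⟩
  -- `#{j : r ≤ j} = n - r` (the tree's `Literature.Barriers.ValiantsHypothesis.card_filter_le_fin`, re-derived inline to
  -- keep the automorphic import cone free of the barrier files)
  have hle : (Finset.univ.filter fun j : Fin n => r ≤ (j : ℕ)).card = n - r := by
    have h := Finset.card_filter_add_card_filter_not (s := (Finset.univ : Finset (Fin n))) (fun i : Fin n => (i : ℕ) < r)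
    have e : (Finset.univ.filter fun j : Fin n => ¬ (j : ℕ) < r) = Finset.univ.filter fun j : Fin n => r ≤ (j : ℕ) :=
      Finset.filter_congr fun j _ => not_lt
    rw [Finset.card_univ, Fintype.card_fin, card_univ_filter_val_lt hr, e] at h
    omega
  rw [hset, Finset.card_product, card_univ_filter_val_lt hr, hle]

section Count

variable [IsDiscreteValuationRing 𝒪[F]] [Finite 𝓀[F]] {ϖ : F} (hϖ : IsUniformizingElement ϖ)
  [IsHeckeTriple (⊤ : Submonoid (GL (Fin n) F)) (glInt n F) (glInt n F)]
include hϖ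

/-- **`#{γ ∈ K t_r K / K : e γ = 𝟙_{i<r}} = q^{r(n-r)}`** (`r ≤ n`, `t_r = diag(ϖ1_r, 1_{n-r}) = ϖ^{𝟙_{i<r}}`): in Herzig's
sum `𝒮_1(T_r) = Σ_{#S = n-r} q^{c(S)} x^{ε_S}` the monomial `x^{𝟙_{i<r}}` comes from `S = {i ≥ r}` alone.
[cite: Herzig2010, Thm. 1.2] [cite: Macdonald1995, Ch. V (2.6), (3.4)] -/
theorem card_filter_iwasawaExp_orbit_heckeDiag_eq_pow {r : ℕ} (hr : r ≤ n)
    [DecidablePred fun γ : GL (Fin n) F ⧸ glInt n F => iwasawaExp hϖ γ.out = fun i : Fin n => if (i : ℕ) < r then (1 : ℤ) else 0] :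
    ((finite_orbit_quotient (glInt n F) (heckeDiag n (Units.mk0 ϖ hϖ.ne_zero) r)).toFinset.filter
        (fun γ => iwasawaExp hϖ γ.out = fun i : Fin n => if (i : ℕ) < r then (1 : ℤ) else 0)).card =
      Nat.card 𝓀[F] ^ (r * (n - r)) := by
  classical
  -- read the coefficient of `x^{𝟙_{i<r}}` in `𝒮_1(T_r)` over `ℤ` in two ways
  have h1 := (isIwasawaExponent_gl hϖ).coeff_satakeTransform_doubleCosetOperator (1 : Multiplicative (Fin n → ℤ) →* ℤ)
    (heckeDiag n (Units.mk0 ϖ hϖ.ne_zero) r) (fun i : Fin n => if (i : ℕ) < r then (1 : ℤ) else 0)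
  rw [MonoidHom.one_apply, mul_one, satakeTransform_one_doubleCosetOperator_heckeDiag hϖ hr, AddMonoidAlgebra.coeff_sum,
    Finsupp.finsetSum_apply] at h1
  rw [Finset.sum_eq_single (Finset.univ.filter fun i : Fin n => r ≤ (i : ℕ))] at h1
  · rw [epsOf_filter_le_eq, AddMonoidAlgebra.coeff_smul, Finsupp.smul_apply, AddMonoidAlgebra.coeff_single,
      Finsupp.single_eq_same, card_echelonPositions_filter_le hr, nsmul_eq_mul, mul_one] at h1
    exact_mod_cast h1.symm
  · intro S _ hS
    rw [AddMonoidAlgebra.coeff_smul, Finsupp.smul_apply, AddMonoidAlgebra.coeff_single, Finsupp.single_apply, if_neg, smul_zero]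
    exact fun h => hS (eq_filter_le_of_epsOf_eq h)
  · intro h
    have hle : (Finset.univ.filter fun j : Fin n => r ≤ (j : ℕ)).card = n - r := by
      have h' := Finset.card_filter_add_card_filter_not (s := (Finset.univ : Finset (Fin n))) (fun i : Fin n => (i : ℕ) < r)
      have e : (Finset.univ.filter fun j : Fin n => ¬ (j : ℕ) < r) = Finset.univ.filter fun j : Fin n => r ≤ (j : ℕ) :=
        Finset.filter_congr fun j _ => not_lt
      rw [Finset.card_univ, Fintype.card_fin, card_univ_filter_val_lt hr, e] at h'
      omega
    exact absurd (Finset.mem_filter.2 ⟨Finset.mem_univ (Finset.univ.filter fun i : Fin n => r ≤ (i : ℕ)), hle⟩) h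

/-- **`E(-𝟙_{i<r}) = [ϖ^{-𝟙_{i<r}} U(𝒪) ϖ^{𝟙_{i<r}} : U(𝒪)] = q^{r(n-r)}`** (`r ≤ n`): the modulus index of the antidominant
generator, by the duality count of g44-#2 and Herzig's count. [cite: Laumon1995, (4.1.4)] [cite: Macdonald1995, Ch. V (2.6)] -/
theorem relIndex_zpowDiagGL_neg_indicator_eq_pow {r : ℕ} (hr : r ≤ n) :
    (unipotentTorusGL hϖ.ne_zero ⊓ glInt n F).relIndex
        (toConjAct (zpowDiagGL hϖ.ne_zero (-fun i : Fin n => if (i : ℕ) < r then (1 : ℤ) else 0)) •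
          (unipotentTorusGL hϖ.ne_zero ⊓ glInt n F)) =
      Nat.card 𝓀[F] ^ (r * (n - r)) := by
  classical
  have hmono : Monotone (-fun i : Fin n => if (i : ℕ) < r then (1 : ℤ) else 0) := by
    intro i j hij
    have hij' : (i : ℕ) ≤ (j : ℕ) := hij
    simp only [Pi.neg_apply, neg_le_neg_iff]
    by_cases hj : (j : ℕ) < r
    · rw [if_pos hj, if_pos (lt_of_le_of_lt hij' hj)]
    · rw [if_neg hj]; split_ifs <;> norm_num
  have h2 := card_filter_iwasawaExp_orbit_heckeDiag_eq_pow hϖ hr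
  simp only [heckeDiag_mk0_eq_zpowDiagGL] at h2
  have h1 := card_filter_iwasawaExp_orbit_zpowDiagGL_neg_eq_relIndex hϖ hmono
  simp only [neg_neg] at h1
  rw [← h1]
  convert h2 using 2

end Count

/-! ## §4 The formula `E(μ) = q^{ψ(μ)}` for every monotone `μ` -/

/-- A monotone non-constant `μ` has a jump at some adjacent pair `k < k + 1`. [cite: Macdonald1995, Ch. V (2.6)] -/
theorem exists_lt_succ_of_monotone_of_ne {μ : Fin n → ℤ} (hμ : Monotone μ) {i j : Fin n} (hij : μ i ≠ μ j) :
    ∃ (k : ℕ) (hk : k + 1 < n), μ ⟨k, Nat.lt_of_succ_lt hk⟩ < μ ⟨k + 1, hk⟩ := by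
  by_contra hcon
  push Not at hcon
  -- no jump: `μ` is constant
  have hconst : ∀ (m : ℕ) (hm : m < n), μ ⟨m, hm⟩ = μ ⟨0, Nat.lt_of_le_of_lt (Nat.zero_le m) hm⟩ := by
    intro m
    induction m with
    | zero => intro hm; rfl
    | succ m ih =>
      intro hm
      have h1 := hcon m hm
      have h2 : μ ⟨m, Nat.lt_of_succ_lt hm⟩ ≤ μ ⟨m + 1, hm⟩ := hμ (Fin.mk_le_mk.2 (Nat.le_succ m))
      rw [← ih (Nat.lt_of_succ_lt hm)]
      exact le_antisymm h1 h2
  exact hij ((hconst i i.2).trans (hconst j j.2).symm)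

/-- Adding `𝟙_{i<k+1}` at a jump `μ_k < μ_{k+1}` keeps `μ` monotone. [cite: Macdonald1995, Ch. V (2.6)] -/
theorem monotone_add_indicator {μ : Fin n → ℤ} (hμ : Monotone μ) {k : ℕ} (hk : k + 1 < n)
    (hjump : μ ⟨k, Nat.lt_of_succ_lt hk⟩ < μ ⟨k + 1, hk⟩) :
    Monotone (μ + fun i : Fin n => if (i : ℕ) < k + 1 then (1 : ℤ) else 0) := by
  intro i j hij
  have hij' : (i : ℕ) ≤ (j : ℕ) := hij
  simp only [Pi.add_apply]
  by_cases hj : (j : ℕ) < k + 1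
  · rw [if_pos hj, if_pos (lt_of_le_of_lt hij' hj)]
    exact add_le_add (hμ hij) le_rfl
  · rw [if_neg hj]
    by_cases hi : (i : ℕ) < k + 1
    · rw [if_pos hi, add_zero]
      have h1 : μ i ≤ μ ⟨k, Nat.lt_of_succ_lt hk⟩ := hμ (Fin.mk_le_mk.2 (Nat.lt_succ_iff.1 hi))
      have h2 : μ ⟨k + 1, hk⟩ ≤ μ j := hμ (Fin.mk_le_mk.2 (not_lt.1 hj))
      omega
    · rw [if_neg hi, add_zero, add_zero]
      exact hμ hij

section Formula

variable [IsDiscreteValuationRing 𝒪[F]] [Finite 𝓀[F]] {ϖ : F} (hϖ : IsUniformizingElement ϖ)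
  [IsHeckeTriple (⊤ : Submonoid (GL (Fin n) F)) (glInt n F) (glInt n F)]
include hϖ

/-- **THE MODULUS OF THE BOREL OF `GL_n` AS AN INDEX**: for `μ` monotone,
`[ϖ^μ U(𝒪) ϖ^{-μ} : U(𝒪)] = q^{ψ(μ)}`, `ψ(μ) = Σᵢ μᵢ (2i + 1 - n) (= Σ_{i<j} (μⱼ - μᵢ)) ≥ 0` — Laumon's
`δ_{B(F)}(b) = ∏_{i<j} |bᵢᵢ/bⱼⱼ|` / Macdonald's `δ(ϖ^μ)` read as an index of open compact subgroups.
[cite: Laumon1995, (4.1.4)] [cite: Macdonald1995, Ch. V (2.6)–(2.7)] [cite: CartierCorvallis1979, §I.3, §IV (4.2)] -/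
theorem relIndex_zpowDiagGL_eq_pow_of_monotone {μ : Fin n → ℤ} (hμ : Monotone μ) :
    0 ≤ ∑ i : Fin n, μ i * (2 * (i : ℕ) + 1 - n) ∧
      (unipotentTorusGL hϖ.ne_zero ⊓ glInt n F).relIndex
          (toConjAct (zpowDiagGL hϖ.ne_zero μ) • (unipotentTorusGL hϖ.ne_zero ⊓ glInt n F)) =
        Nat.card 𝓀[F] ^ (∑ i : Fin n, μ i * (2 * (i : ℕ) + 1 - n)).toNat := by
  -- induction on the total rise `μ_{n-1} - μ_0`
  suffices h : ∀ (d : ℕ) (μ : Fin n → ℤ), Monotone μ → (∀ i j : Fin n, μ j - μ i ≤ d) →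
      0 ≤ ∑ i : Fin n, μ i * (2 * (i : ℕ) + 1 - n) ∧
        (unipotentTorusGL hϖ.ne_zero ⊓ glInt n F).relIndex
            (toConjAct (zpowDiagGL hϖ.ne_zero μ) • (unipotentTorusGL hϖ.ne_zero ⊓ glInt n F)) =
          Nat.card 𝓀[F] ^ (∑ i : Fin n, μ i * (2 * (i : ℕ) + 1 - n)).toNat by
    rcases Nat.eq_zero_or_pos n with hn | hn
    · subst hn
      exact h 0 μ hμ fun i => Fin.elim0 i
    · refine h (μ ⟨n - 1, by omega⟩ - μ ⟨0, hn⟩).toNat μ hμ fun i j => ?_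
      have h1 : μ j ≤ μ ⟨n - 1, by omega⟩ := hμ (Fin.mk_le_mk.2 (by have := j.2; omega))
      have h2 : μ ⟨0, hn⟩ ≤ μ i := hμ (Fin.mk_le_mk.2 (Nat.zero_le _))
      have := Int.self_le_toNat (μ ⟨n - 1, by omega⟩ - μ ⟨0, hn⟩)
      omega
  intro d
  induction d with
  | zero =>
    intro μ hμ hd
    -- `μ` is constant
    have hc : ∀ i : Fin n, μ i = μ ⟨0, Nat.lt_of_le_of_lt (Nat.zero_le _) i.2⟩ := fun i =>
      le_antisymm (by have := hd ⟨0, Nat.lt_of_le_of_lt (Nat.zero_le _) i.2⟩ i; push_cast at this; omega)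
        (hμ (Fin.mk_le_mk.2 (Nat.zero_le _)))
    rcases Nat.eq_zero_or_pos n with hn | hn
    · subst hn
      refine ⟨by simp, ?_⟩
      rw [show μ = fun _ => (0 : ℤ) from funext fun i => Fin.elim0 i, relIndex_zpowDiagGL_const hϖ]
      simp
    · have hμc : μ = fun _ => μ ⟨0, hn⟩ := funext fun i => hc i
      have hψ : ∑ i : Fin n, μ i * (2 * (i : ℕ) + 1 - n) = 0 := by
        have h0 := sum_ite_lt_mul_two_mul_add_one_sub (n := n) le_rfl
        rw [hμc, ← Finset.mul_sum]
        rw [show ∑ i : Fin n, (if (i : ℕ) < n then (1 : ℤ) else 0) * (2 * (i : ℕ) + 1 - n) =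
          ∑ i : Fin n, (2 * ((i : ℕ) : ℤ) + 1 - n) from Finset.sum_congr rfl fun i _ => by rw [if_pos i.2, one_mul],
          sub_self, mul_zero, neg_zero] at h0
        rw [h0, mul_zero]
      refine ⟨hψ.ge, ?_⟩
      rw [hμc, relIndex_zpowDiagGL_const hϖ, ← hμc, hψ, Int.toNat_zero, pow_zero]
  | succ d ih =>
    intro μ hμ hd
    by_cases hcase : ∀ i j : Fin n, μ j - μ i ≤ d
    · exact ih μ hμ hcase
    push Not at hcase
    obtain ⟨i₀, j₀, hij₀⟩ := hcase
    have hne : μ i₀ ≠ μ j₀ := fun h => by rw [h, sub_self] at hij₀; have := hij₀; omega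
    obtain ⟨k, hk, hjump⟩ := exists_lt_succ_of_monotone_of_ne hμ hne
    -- `μ' = μ + 𝟙_{i<k+1}` is monotone with rise `≤ d`, and `μ = μ' + (-𝟙_{i<k+1})`
    set ω : Fin n → ℤ := fun i => if (i : ℕ) < k + 1 then (1 : ℤ) else 0 with hω
    have hμ' : Monotone (μ + ω) := monotone_add_indicator hμ hk hjump
    have hd' : ∀ i j : Fin n, (μ + ω) j - (μ + ω) i ≤ d := by
      intro i j
      have htop := hd ⟨0, by omega⟩ ⟨n - 1, by omega⟩
      have hdij := hd i j
      have hjn : μ j ≤ μ ⟨n - 1, by omega⟩ := hμ (Fin.mk_le_mk.2 (by have := j.2; omega))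
      have h0i : μ ⟨0, by omega⟩ ≤ μ i := hμ (Fin.mk_le_mk.2 (Nat.zero_le _))
      have h0k : μ ⟨0, by omega⟩ ≤ μ ⟨k, Nat.lt_of_succ_lt hk⟩ := hμ (Fin.mk_le_mk.2 (Nat.zero_le _))
      have hk1n : μ ⟨k + 1, hk⟩ ≤ μ ⟨n - 1, by omega⟩ := hμ (Fin.mk_le_mk.2 (by omega))
      simp only [Pi.add_apply, hω]
      by_cases hj : (j : ℕ) < k + 1
      · have hjk : μ j ≤ μ ⟨k, Nat.lt_of_succ_lt hk⟩ := hμ (Fin.mk_le_mk.2 (Nat.lt_succ_iff.1 hj))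
        by_cases hi : (i : ℕ) < k + 1
        · rw [if_pos hj, if_pos hi]; omega
        · rw [if_pos hj, if_neg hi]
          have hki : μ ⟨k + 1, hk⟩ ≤ μ i := hμ (Fin.mk_le_mk.2 (not_lt.1 hi))
          omega
      · have hkj : μ ⟨k + 1, hk⟩ ≤ μ j := hμ (Fin.mk_le_mk.2 (not_lt.1 hj))
        by_cases hi : (i : ℕ) < k + 1
        · rw [if_neg hj, if_pos hi]
          omega
        · rw [if_neg hj, if_neg hi]
          have hki : μ ⟨k + 1, hk⟩ ≤ μ i := hμ (Fin.mk_le_mk.2 (not_lt.1 hi))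
          omega
    obtain ⟨hψ', hE'⟩ := ih (μ + ω) hμ' hd'
    have hωmono : Monotone (-ω) := by
      intro i j hij
      have hij' : (i : ℕ) ≤ (j : ℕ) := hij
      simp only [Pi.neg_apply, neg_le_neg_iff, hω]
      by_cases hj : (j : ℕ) < k + 1
      · rw [if_pos hj, if_pos (lt_of_le_of_lt hij' hj)]
      · rw [if_neg hj]; split_ifs <;> norm_num
    have hdec : μ = (μ + ω) + (-ω) := by rw [add_neg_cancel_right]
    have hψω : ∑ i : Fin n, (-ω) i * (2 * (i : ℕ) + 1 - n) = (k + 1 : ℕ) * (n - (k + 1) : ℕ) := by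
      have h0 := sum_ite_lt_mul_two_mul_add_one_sub (n := n) hk.le
      simp only [hω, Pi.neg_apply, neg_mul]
      rw [Finset.sum_neg_distrib, h0, neg_neg]
      push_cast [Nat.cast_sub hk.le]
      ring
    have hψ : ∑ i : Fin n, μ i * (2 * (i : ℕ) + 1 - n) =
        ∑ i : Fin n, (μ + ω) i * (2 * (i : ℕ) + 1 - n) + (k + 1 : ℕ) * (n - (k + 1) : ℕ) := by
      conv_lhs => rw [hdec]
      rw [sum_mul_two_mul_add_one_sub_add, hψω]
    refine ⟨by rw [hψ]; positivity, ?_⟩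
    rw [hψ]
    conv_lhs => rw [hdec]
    rw [relIndex_zpowDiagGL_add_of_monotone hϖ hμ' hωmono, hE', relIndex_zpowDiagGL_neg_indicator_eq_pow hϖ hk.le,
      ← pow_add]
    congr 1
    have e : ((k + 1 : ℕ) * (n - (k + 1) : ℕ) : ℤ) = (((k + 1) * (n - (k + 1)) : ℕ) : ℤ) := by push_cast; ring
    rw [e, Int.toNat_add_nat hψ']

/-- `ψ(μ) ≥ 0` for `μ` monotone. [cite: Macdonald1995, Ch. V (2.6)] -/
theorem sum_mul_two_mul_add_one_sub_nonneg_of_monotone {μ : Fin n → ℤ} (hμ : Monotone μ) :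
    0 ≤ ∑ i : Fin n, μ i * (2 * (i : ℕ) + 1 - n) :=
  (relIndex_zpowDiagGL_eq_pow_of_monotone hϖ hμ).1

/-! ## §5 The index ratio for every `μ`, the duality with `δ_B` explicit, the dominant-extreme count -/

/-- **The index ratio for EVERY `μ ∈ ℤⁿ` is `q^{ψ(μ)}`**: `[ϖ^μU : U ∩ ϖ^μU] · q^{ψ(μ)⁻} = [U : U ∩ ϖ^μU] · q^{ψ(μ)⁺}`
(`U = U(𝒪)`, conjugates abbreviated; `ψ⁺ = max(ψ, 0)`, `ψ⁻ = max(-ψ, 0)`), from the monotone case applied to `λ` and `μ + λ`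
for the monotone `λᵢ = c·i` with `c` larger than every drop of `μ`. [cite: Laumon1995, (4.1.4)] [cite: Macdonald1995, Ch. V (2.6)] -/
theorem relIndex_zpowDiagGL_mul_pow_eq (μ : Fin n → ℤ) :
    (unipotentTorusGL hϖ.ne_zero ⊓ glInt n F).relIndex
          (toConjAct (zpowDiagGL hϖ.ne_zero μ) • (unipotentTorusGL hϖ.ne_zero ⊓ glInt n F)) *
        Nat.card 𝓀[F] ^ (-∑ i : Fin n, μ i * (2 * (i : ℕ) + 1 - n)).toNat =
      (toConjAct (zpowDiagGL hϖ.ne_zero μ) • (unipotentTorusGL hϖ.ne_zero ⊓ glInt n F)).relIndex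
          (unipotentTorusGL hϖ.ne_zero ⊓ glInt n F) *
        Nat.card 𝓀[F] ^ (∑ i : Fin n, μ i * (2 * (i : ℕ) + 1 - n)).toNat := by
  classical
  -- a monotone `λ` with `μ + λ` monotone: `λ i = c · i` with `c ≥` every drop of `μ`
  obtain ⟨c, hc⟩ : ∃ c : ℤ, 0 ≤ c ∧ ∀ i j : Fin n, μ i - μ j ≤ c := by
    refine ⟨∑ i : Fin n, |μ i| + ∑ i : Fin n, |μ i|, by positivity, fun i j => ?_⟩
    have h1 : |μ i| ≤ ∑ i : Fin n, |μ i| := Finset.single_le_sum (fun i _ => abs_nonneg (μ i)) (Finset.mem_univ i)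
    have h2 : |μ j| ≤ ∑ i : Fin n, |μ i| := Finset.single_le_sum (fun i _ => abs_nonneg (μ i)) (Finset.mem_univ j)
    have h3 := le_abs_self (μ i); have h4 := neg_abs_le (μ j)
    omega
  set lam : Fin n → ℤ := fun i => c * (i : ℕ) with hlam
  have hlam_mono : Monotone lam := fun i j hij => by
    have hij' : ((i : ℕ) : ℤ) ≤ ((j : ℕ) : ℤ) := by exact_mod_cast (show (i : ℕ) ≤ (j : ℕ) from hij)
    exact mul_le_mul_of_nonneg_left hij' hc.1
  have hsum_mono : Monotone (μ + lam) := fun i j hij => by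
    rcases eq_or_lt_of_le hij with h | h
    · rw [h]
    · have hij' : ((i : ℕ) : ℤ) + 1 ≤ ((j : ℕ) : ℤ) := by exact_mod_cast (show (i : ℕ) < (j : ℕ) from h)
      simp only [Pi.add_apply, hlam]
      have := hc.2 i j
      nlinarith [hc.1]
  -- the multiplicativity identity at `(μ + λ, -λ)`… better: at `(μ, λ)`: `i₂(μ+λ) i₁(μ) i₁(λ) = i₁(μ+λ) i₂(μ) i₂(λ)`
  have key := relIndex_conj_zpowDiagGL_mul hϖ μ lam
  obtain ⟨hψ1, hE1⟩ := relIndex_zpowDiagGL_eq_pow_of_monotone hϖ hsum_mono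
  obtain ⟨hψ2, hE2⟩ := relIndex_zpowDiagGL_eq_pow_of_monotone hϖ hlam_mono
  rw [relIndex_conjAct_zpowDiagGL_smul_eq_one_of_monotone hϖ hsum_mono, hE1, hE2,
    relIndex_conjAct_zpowDiagGL_smul_eq_one_of_monotone hϖ hlam_mono, one_mul, mul_one] at key
  -- `key : i₁(μ) * q^{ψ(λ)} = q^{ψ(μ+λ)} * i₂(μ)` with `ψ(μ+λ) = ψ(μ) + ψ(λ)`
  have hq : 0 < Nat.card 𝓀[F] := by
    haveI : Fintype 𝓀[F] := Fintype.ofFinite _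
    rw [Nat.card_eq_fintype_card]; exact Fintype.card_pos
  have hadd : (∑ i : Fin n, (μ + lam) i * (2 * (i : ℕ) + 1 - n)).toNat =
      (∑ i : Fin n, μ i * (2 * (i : ℕ) + 1 - n) + ∑ i : Fin n, lam i * (2 * (i : ℕ) + 1 - n)).toNat := by
    rw [sum_mul_two_mul_add_one_sub_add]
  rw [hadd] at key
  -- case on the sign of `ψ(μ)`
  set A := ∑ i : Fin n, μ i * (2 * (i : ℕ) + 1 - n) with hA
  set B := ∑ i : Fin n, lam i * (2 * (i : ℕ) + 1 - n) with hB
  rcases le_or_gt 0 A with hA0 | hA0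
  · rw [Int.toNat_of_nonpos (by omega), pow_zero, mul_one]
    have e : (A + B).toNat = A.toNat + B.toNat := by
      have := Int.toNat_of_nonneg hA0; have := Int.toNat_of_nonneg hψ2; have := Int.toNat_of_nonneg (add_nonneg hA0 hψ2)
      omega
    rw [e, pow_add] at key
    -- `key : i₁ * q^B = q^A * q^B * i₂`
    have hqB : Nat.card 𝓀[F] ^ B.toNat ≠ 0 := pow_ne_zero _ hq.ne'
    have key' : (unipotentTorusGL hϖ.ne_zero ⊓ glInt n F).relIndex
        (toConjAct (zpowDiagGL hϖ.ne_zero μ) • (unipotentTorusGL hϖ.ne_zero ⊓ glInt n F)) * Nat.card 𝓀[F] ^ B.toNat =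
        ((toConjAct (zpowDiagGL hϖ.ne_zero μ) • (unipotentTorusGL hϖ.ne_zero ⊓ glInt n F)).relIndex
          (unipotentTorusGL hϖ.ne_zero ⊓ glInt n F) * Nat.card 𝓀[F] ^ A.toNat) * Nat.card 𝓀[F] ^ B.toNat := by
      rw [key]; ring
    exact mul_right_cancel₀ hqB key'
  · rw [Int.toNat_of_nonpos hA0.le, pow_zero, mul_one]
    have e : B.toNat = (A + B).toNat + (-A).toNat := by
      have := Int.toNat_of_nonneg hψ1; have := Int.toNat_of_nonneg hψ2
      have := Int.toNat_of_nonneg (show 0 ≤ -A by omega)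
      rw [sum_mul_two_mul_add_one_sub_add] at hψ1
      omega
    rw [e, pow_add] at key
    have hqAB : Nat.card 𝓀[F] ^ (A + B).toNat ≠ 0 := pow_ne_zero _ hq.ne'
    have key' : ((unipotentTorusGL hϖ.ne_zero ⊓ glInt n F).relIndex
        (toConjAct (zpowDiagGL hϖ.ne_zero μ) • (unipotentTorusGL hϖ.ne_zero ⊓ glInt n F)) * Nat.card 𝓀[F] ^ (-A).toNat) *
          Nat.card 𝓀[F] ^ (A + B).toNat =
        (toConjAct (zpowDiagGL hϖ.ne_zero μ) • (unipotentTorusGL hϖ.ne_zero ⊓ glInt n F)).relIndex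
          (unipotentTorusGL hϖ.ne_zero ⊓ glInt n F) * Nat.card 𝓀[F] ^ (A + B).toNat :=
      calc (unipotentTorusGL hϖ.ne_zero ⊓ glInt n F).relIndex
              (toConjAct (zpowDiagGL hϖ.ne_zero μ) • (unipotentTorusGL hϖ.ne_zero ⊓ glInt n F)) * Nat.card 𝓀[F] ^ (-A).toNat *
            Nat.card 𝓀[F] ^ (A + B).toNat
          = (unipotentTorusGL hϖ.ne_zero ⊓ glInt n F).relIndex
              (toConjAct (zpowDiagGL hϖ.ne_zero μ) • (unipotentTorusGL hϖ.ne_zero ⊓ glInt n F)) *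
            (Nat.card 𝓀[F] ^ (A + B).toNat * Nat.card 𝓀[F] ^ (-A).toNat) := by ring
        _ = Nat.card 𝓀[F] ^ (A + B).toNat * (toConjAct (zpowDiagGL hϖ.ne_zero μ) • (unipotentTorusGL hϖ.ne_zero ⊓ glInt n F)).relIndex
              (unipotentTorusGL hϖ.ne_zero ⊓ glInt n F) := key
        _ = _ := mul_comm _ _
    exact mul_right_cancel₀ hqAB key'

/-- **THE DUALITY FOR `GL_n` WITH `δ_B` EXPLICIT**: for every `g ∈ GL_n(F)` and `μ ∈ ℤⁿ`,
`#{γ ∈ KgK/K : e γ = μ} · q^{ψ(μ)⁺} = #{γ ∈ Kg⁻¹K/K : e γ = -μ} · q^{ψ(μ)⁻}`, `ψ(μ) = Σᵢ μᵢ(2i + 1 - n) = Σ_{i<j}(μⱼ - μᵢ)`,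
i.e. `N(g, μ) = δ_B(ϖ^μ) N(g⁻¹, -μ)` with `δ_B(ϖ^μ) = ∏_{i<j} |ϖ^{μᵢ-μⱼ}| = q^{-ψ(μ)}`.
[cite: CartierCorvallis1979, §IV (4.2), Thm. 4.1] [cite: Laumon1995, (4.1.4)–(4.1.6)] [cite: Macdonald1995, Ch. V (2.6)–(2.7)] -/
theorem card_filter_iwasawaExp_mul_pow_eq (g : GL (Fin n) F) (μ : Fin n → ℤ)
    [DecidablePred fun α : GL (Fin n) F ⧸ glInt n F => iwasawaExp hϖ α.out = μ]
    [DecidablePred fun α : GL (Fin n) F ⧸ glInt n F => iwasawaExp hϖ α.out = -μ] :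
    ((finite_orbit_quotient (glInt n F) g).toFinset.filter (fun α => iwasawaExp hϖ α.out = μ)).card *
        Nat.card 𝓀[F] ^ (∑ i : Fin n, μ i * (2 * (i : ℕ) + 1 - n)).toNat =
      ((finite_orbit_quotient (glInt n F) g⁻¹).toFinset.filter (fun α => iwasawaExp hϖ α.out = -μ)).card *
        Nat.card 𝓀[F] ^ (-∑ i : Fin n, μ i * (2 * (i : ℕ) + 1 - n)).toNat := by
  have hD := card_filter_iwasawaExp_mul_relIndex_eq hϖ g μ
  have hR := relIndex_zpowDiagGL_mul_pow_eq hϖ μ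
  have hi₂ : (toConjAct (zpowDiagGL hϖ.ne_zero μ) • (unipotentTorusGL hϖ.ne_zero ⊓ glInt n F)).relIndex
      (unipotentTorusGL hϖ.ne_zero ⊓ glInt n F) ≠ 0 :=
    IsIwasawaExponent.relIndex_conj_ne_zero (K := glInt n F) (zpowDiagGL_mem_unipotentTorusGL hϖ.ne_zero μ)
  have hi₁ : (unipotentTorusGL hϖ.ne_zero ⊓ glInt n F).relIndex
      (toConjAct (zpowDiagGL hϖ.ne_zero μ) • (unipotentTorusGL hϖ.ne_zero ⊓ glInt n F)) ≠ 0 :=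
    IsIwasawaExponent.relIndex_conj_ne_zero' (K := glInt n F) (zpowDiagGL_mem_unipotentTorusGL hϖ.ne_zero μ)
  -- `N₁ i₁ = N₂ i₂` and `i₂ qm = i₁ qp` ⇒ `N₁ qp i₁ i₂ = N₂ qm i₁ i₂`
  set N₁ := ((finite_orbit_quotient (glInt n F) g).toFinset.filter (fun α => iwasawaExp hϖ α.out = μ)).card
  set N₂ := ((finite_orbit_quotient (glInt n F) g⁻¹).toFinset.filter (fun α => iwasawaExp hϖ α.out = -μ)).card
  set i₁ := (unipotentTorusGL hϖ.ne_zero ⊓ glInt n F).relIndex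
      (toConjAct (zpowDiagGL hϖ.ne_zero μ) • (unipotentTorusGL hϖ.ne_zero ⊓ glInt n F))
  set i₂ := (toConjAct (zpowDiagGL hϖ.ne_zero μ) • (unipotentTorusGL hϖ.ne_zero ⊓ glInt n F)).relIndex
      (unipotentTorusGL hϖ.ne_zero ⊓ glInt n F)
  set qp := Nat.card 𝓀[F] ^ (∑ i : Fin n, μ i * (2 * (i : ℕ) + 1 - n)).toNat
  set qm := Nat.card 𝓀[F] ^ (-∑ i : Fin n, μ i * (2 * (i : ℕ) + 1 - n)).toNat
  have h : N₁ * qp * (i₁ * i₂) = N₂ * qm * (i₁ * i₂) := by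
    calc N₁ * qp * (i₁ * i₂) = (N₁ * i₁) * (i₂ * qp) := by ring
      _ = (N₂ * i₂) * (i₁ * qm) := by rw [hD, ← hR]
      _ = N₂ * qm * (i₁ * i₂) := by ring
  exact mul_right_cancel₀ (mul_ne_zero hi₁ hi₂) h

/-- **The dominant-extreme count**: for `λ` ANTITONE, `#{γ ∈ K ϖ^λ K / K : e γ = λ} = q^{Σᵢ λᵢ (n - 1 - 2i)} = q^{Σ_{i<j}(λᵢ - λⱼ)}`
(`= q^{⟨λ, 2ρ⟩}`: the number of left cosets of `Kϖ^λK` at the dominant extreme; Macdonald's leading term of `c_λ`).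
[cite: Macdonald1995, Ch. V (2.6)–(2.9)] [cite: BruhatTits1972, Prop. (4.4.4)] -/
theorem card_filter_iwasawaExp_orbit_zpowDiagGL_eq_pow {lam : Fin n → ℤ} (hlam : Antitone lam)
    [DecidablePred fun γ : GL (Fin n) F ⧸ glInt n F => iwasawaExp hϖ γ.out = lam] :
    ((finite_orbit_quotient (glInt n F) (zpowDiagGL hϖ.ne_zero lam)).toFinset.filter
        (fun γ => iwasawaExp hϖ γ.out = lam)).card =
      Nat.card 𝓀[F] ^ (∑ i : Fin n, (-lam) i * (2 * (i : ℕ) + 1 - n)).toNat := by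
  classical
  have h := card_filter_iwasawaExp_orbit_zpowDiagGL_neg_eq_relIndex hϖ (a := -lam) hlam.neg
  simp only [neg_neg] at h
  rw [(relIndex_zpowDiagGL_eq_pow_of_monotone hϖ (μ := -lam) hlam.neg).2] at h
  convert h using 2

end Formula

end Literature.NumberTheory.Automorphic

end
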